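import Literature.Computability.AlgebraicComplexity.BI17FundamentalInvariantTensors
import Literature.Computability.AlgebraicComplexity.QuantumFunctionalsDegenerationProofs
import Literature.Barriers.MatrixMultiplication.UnstableTensorBarrierMinimalBorderRank
import HarnessLib

/-!
# Unstable tensors are not polystable: the weight test against BI 2017 Prop. 4.8's conclusion

P. Bürgisser, C. Ikenmeyer, *Fundamental invariants of orbit closures*, J. Algebra **477** (2017)
390–434 [BurgisserIkenmeyer2017], §4.2: a tensor `w ∈ ⊗³ℂ^m` is polystable iff its `SL_m³`-orbit is
closed (the tree's `IsPolystableTensor`, Euclidean closedness of the orbit-map range), and the proof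
of Prop. 4.8 (held text `paper:arxiv-1511.02927` p0017:L5–20) runs the diagonal one-parameter
subgroups `(diag(t^μ), diag(t^ν), diag(t^π))`: "`lim_{t→0}` … exists iff `μ_i + ν_j + π_k ≥ 0` on
`supp(w)`".

This file is the TENSOR twin of `FormTorusInstability.lean`: it bridges the barrier vocabulary
`Literature.Barriers.MatrixMultiplication.IsUnstable` (`0 ∈ closure(SL³·t)`,
`UnstableTensorBarrier.lean`; weight test `isUnstable_of_sepWeight`,
`UnstableTensorBarrierMinimalBorderRank.lean`) to BI's notion: a NONZERO unstable tensor is not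
polystable (`IsUnstable.not_isPolystableTensor`), hence a positive traceless weight triple on the
support refutes polystability (`not_isPolystableTensor_of_posWeight`) — the necessity of the cone
hypothesis 2 of Prop. 4.8; example: a basis tensor `e_a ⊗ e_b ⊗ e_c` in `m ≥ 2`
(`not_isPolystableTensor_single`).

THEOREMS ONLY; cell `val-lit`, tooling around erratum A31. Honest framing: textbook GIT
bookkeeping; VP ≠ VNP is NOT proved and nothing here bears on it.
-/

noncomputable section

open Literature.Barriers.MatrixMultiplication

namespace Literature.Computability.AlgebraicComplexity

variable {ι : Type} [Fintype ι] [DecidableEq ι]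

/-- **A nonzero unstable tensor is not polystable**: if `0` lies in the closure of `SL³·w` and the
orbit is closed then `0 = g·w` for some `g ∈ SL³`, so `w = g⁻¹·0 = 0`.
[cite: BurgisserIkenmeyer2017, §4.2 (polystable = closed SL³-orbit; proof of Prop. 4.8)] -/
theorem _root_.Literature.Barriers.MatrixMultiplication.IsUnstable.not_isPolystableTensor
    {w : ι → ι → ι → ℂ} (hu : IsUnstable w) (hw : w ≠ 0) : ¬ IsPolystableTensor w := by
  intro hps
  have h0 := hps.closure_subset hu
  obtain ⟨g, hg⟩ := h0
  apply hw
  have h1 := congrArg (actTensor (((g.1)⁻¹ : Matrix.SpecialLinearGroup ι ℂ) : Matrix ι ι ℂ)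
    (((g.2.1)⁻¹ : Matrix.SpecialLinearGroup ι ℂ) : Matrix ι ι ℂ)
    (((g.2.2)⁻¹ : Matrix.SpecialLinearGroup ι ℂ) : Matrix ι ι ℂ)) hg
  simp only at h1
  rw [actTensor_actTensor, ← Matrix.SpecialLinearGroup.coe_mul, ← Matrix.SpecialLinearGroup.coe_mul,
    ← Matrix.SpecialLinearGroup.coe_mul, inv_mul_cancel, inv_mul_cancel, inv_mul_cancel,
    Matrix.SpecialLinearGroup.coe_one, actTensor_one, actTensor_zero] at h1
  exact h1

/-- **Positive traceless weights refute polystability** (necessity of hypothesis 2 of BI 2017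
Prop. 4.8): if `x, y, z` are real weights with zero sums and `x_a + y_b + z_c > 0` on `supp(w)`,
`w ≠ 0`, then `w` is not polystable (`(diag e^{-sx}, diag e^{-sy}, diag e^{-sz}) · w → 0`).
[cite: BurgisserIkenmeyer2017, §4.2 (proof of Prop. 4.8)] -/
theorem not_isPolystableTensor_of_posWeight (w : ι → ι → ι → ℂ) (hw : w ≠ 0) (x y z : ι → ℝ)
    (hx : ∑ a, x a = 0) (hy : ∑ b, y b = 0) (hz : ∑ c, z c = 0)
    (hsep : ∀ a b c, w a b c ≠ 0 → 0 < x a + y b + z c) : ¬ IsPolystableTensor w :=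
  (isUnstable_of_sepWeight w x y z hx hy hz hsep).not_isPolystableTensor hw

omit [DecidableEq ι] in
/-- The traceless weight `e_a − e_{a'}` on `ι` (as a real function) has zero sum. [folklore] -/
private theorem sum_ite_sub_ite [DecidableEq ι] (a a' : ι) :
    ∑ i, ((if i = a then (1 : ℝ) else 0) - (if i = a' then 1 else 0)) = 0 := by
  rw [Finset.sum_sub_distrib, Finset.sum_ite_eq', Finset.sum_ite_eq']
  simp

/-- **Example: a basis tensor `e_a ⊗ e_b ⊗ e_c` (`|ι| ≥ 2`) is not polystable** — with `a' ≠ a`,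
`b' ≠ b`, `c' ≠ c` the weights `x = e_a − e_{a'}`, `y = e_b − e_{b'}`, `z = e_c − e_{c'}` are
traceless and sum to `3 > 0` at the single support point.
[cite: BurgisserIkenmeyer2017, §4.2 (proof of Prop. 4.8)] -/
theorem not_isPolystableTensor_single {a b c a' : ι} (ha : a ≠ a') (v : ℂ) (hv : v ≠ 0) :
    ¬ IsPolystableTensor (fun i j k => if i = a ∧ j = b ∧ k = c then v else 0) := by
  classical
  -- a second index different from `b`, resp. `c`
  have hex : ∀ e : ι, ∃ e' : ι, e ≠ e' := by
    intro e
    by_cases he : e = a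
    · exact ⟨a', he ▸ ha⟩
    · exact ⟨a, he⟩
  obtain ⟨b', hb⟩ := hex b
  obtain ⟨c', hc⟩ := hex c
  refine not_isPolystableTensor_of_posWeight _ ?_
    (fun i => (if i = a then 1 else 0) - (if i = a' then 1 else 0))
    (fun j => (if j = b then 1 else 0) - (if j = b' then 1 else 0))
    (fun k => (if k = c then 1 else 0) - (if k = c' then 1 else 0))
    (sum_ite_sub_ite a a') (sum_ite_sub_ite b b') (sum_ite_sub_ite c c') ?_
  · intro h
    have := congr_fun (congr_fun (congr_fun h a) b) c
    simp [hv] at this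
  · intro i j k hne
    by_cases hijk : i = a ∧ j = b ∧ k = c
    · obtain ⟨rfl, rfl, rfl⟩ := hijk
      simp only [if_true, if_neg ha, if_neg hb, if_neg hc]
      norm_num
    · exact absurd (if_neg hijk) hne

end Literature.Computability.AlgebraicComplexity
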